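import Summits.QuantumAdvantage.QuantumAdvantage.Theorems.CompactnessPrinciple.Negative.StubFuelledClockFalse
import HarnessLib

/-!
# Crux `CompactnessPrinciple` (stmt-QuantumAdvantage-15270), line `coin-padding-slices`: no guard polynomial rescues the clock stub

Standing disprover (refuter-cdisprove-stmt-QuantumAdvantage-15270-0, 2026-08-17); sharpens the landed
`Negative/StubFuelledClockFalse.lean` (refuter-skel-…-vet-0, p154598: the registered stub
`stub_fuelledClock : ∀ p B, ∃ a, TimeComputable id id (clockFn p B) (a · n + a)` is false at
`(p, B) = (X², 0)`; repair: add `∀ n, p.eval n ≤ B.eval n`).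

What this file adds — the exact shape of the admissible repairs:

* `clock_not_linearTime` — the GENERAL CRITERION behind the witness: any function agreeing with the
  fuel-guarded clock `⟨x, r⟩ ↦ 1^{p |x|} 0 ⟨x, r⟩` on the guard-passing well-formed pairs
  (`B |x| ≤ |r|`) is not linear-time computable as soon as `p ∉ O(B + X)`, i.e.
  `∀ κ, ∃ n, κ · (B n + n + 1) < p n` (input `⟨1ⁿ, 1^{B n}⟩`: output `p n + 1 + |w|` symbols versus
  `|w| + D (a |w| + a) ≤ |w| + 3 D a (B n + n + 1)` by `OutputsWithin.length_le`);
* `stub_fuelledClock_false_of_guard` — consequently NO condition on the guard `B` alone repairs the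
  stub: for EVERY `B` the exponent `p = X · (B + X + 1)` breaks linear time. The repair must RELATE
  `p` to `B` — domination `p ≤ B` pointwise (the vet seat's repair, matching the line's only use site
  `B = budget p c' k`), or more generally `p = O(B + X)`, which is also where the criterion stops.

Stated for an arbitrary `clockFn` satisfying the clock specification on guard-passing pairs (for the
line's `clockFn`: `hclock := fun p B x r h => by simp [clockFn, h]`). Sorry-free; no definitions.
-/

set_option linter.dupNamespace false

namespace Summit.QuantumAdvantage.QuantumAdvantage.Theorems.CompactnessPrinciple.Negative

open Polynomial
open Literature.Computability.Complexity
open Literature.Computability.Complexity.TM2Comp (machinePushBound)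

/-- **General criterion.** If `f` agrees with the fuel-guarded clock `w ↦ 1^{p |x|} 0 w` on the
well-formed pairs `w = ⟨x, r⟩` passing the guard `B |x| ≤ |r|`, and `p` is not `O(B + X)`
(`∀ κ, ∃ n, κ · (B n + n + 1) < p n`), then `f` is not computable in linear time: on
`w = ⟨1ⁿ, 1^{B n}⟩` the output has length `p n + 1 + |w|`, but a machine running `a |w| + a` steps
writes at most `|w| + D (a |w| + a) ≤ |w| + 3 D a (B n + n + 1)` symbols
(`OutputsWithin.length_le`, `D = machinePushBound`). [folklore] -/
theorem clock_not_linearTime {p B : Polynomial ℕ} (f : List Bool → List Bool)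
    (hf : ∀ x r : List Bool, B.eval x.length ≤ r.length →
      f (boolPair x r) = ones (p.eval x.length) ++ false :: boolPair x r)
    (hgrow : ∀ κ : ℕ, ∃ n, κ * (B.eval n + n + 1) < p.eval n) :
    ¬ ∃ a : ℕ, TimeComputable id id f fun n => a * n + a := by
  rintro ⟨a, M, hM⟩
  obtain ⟨n, hn⟩ := hgrow (3 * (machinePushBound M.tm * a))
  have hw := hM (boolPair (ones n) (ones (B.eval n)))
  have hlen := Turing.TM2ComputableAux.OutputsWithin.length_le hw
  rw [id, hf (ones n) (ones (B.eval n)) (by simp)] at hlen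
  simp only [id, List.length_append, List.length_replicate, List.length_cons, length_boolPair]
    at hlen
  generalize machinePushBound M.tm = D at hlen hn
  generalize B.eval n = b at hlen hn
  have key : D * (a * (2 * n + 2 + b) + a) ≤ 3 * (D * a) * (b + n + 1) := by
    rw [show D * (a * (2 * n + 2 + b) + a) = (D * a) * (2 * n + 3 + b) by ring]
    rw [show 3 * (D * a) * (b + n + 1) = (D * a) * (3 * b + 3 * n + 3) by ring]
    exact Nat.mul_le_mul_left _ (by omega)
  omega

/-- **No guard polynomial rescues `stub_fuelledClock`**: for EVERY `B`, the clock with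
`p = X · (B + X + 1)` is not linear time (`κ (B n + n + 1) < n (B n + n + 1)` at `n = κ + 1`).
Hence the admissible repairs are relations between `p` and `B` (`p ≤ B` pointwise, as at the line's
use site `B = budget p c' k`; in general `p = O(B + X)`), never conditions on `B` alone. [folklore] -/
theorem stub_fuelledClock_false_of_guard
    (clockFn : Polynomial ℕ → Polynomial ℕ → List Bool → List Bool)
    (hclock : ∀ (p B : Polynomial ℕ) (x r : List Bool), B.eval x.length ≤ r.length →
      clockFn p B (boolPair x r) = ones (p.eval x.length) ++ false :: boolPair x r)
    (B : Polynomial ℕ) :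
    ¬ ∀ p : Polynomial ℕ, ∃ a : ℕ, TimeComputable id id (clockFn p B) fun n => a * n + a := by
  intro h
  refine clock_not_linearTime (p := X * (B + X + 1)) (B := B) (clockFn (X * (B + X + 1)) B)
    (hclock _ _) ?_ (h _)
  intro κ
  refine ⟨κ + 1, ?_⟩
  simp only [eval_mul, eval_add, eval_X, eval_one]
  nlinarith [Nat.zero_le (B.eval (κ + 1))]

/-- The landed witness is the instance `(p, B) = (X², 0)` of the criterion (growth `κ (n + 1) < n²`
at `n = κ + 2`), for any `clockFn` with the clock specification — a second route to
`stub_fuelledClock_false` of `StubFuelledClockFalse.lean`. [folklore] -/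
theorem stub_fuelledClock_false'
    (clockFn : Polynomial ℕ → Polynomial ℕ → List Bool → List Bool)
    (hclock : ∀ (p B : Polynomial ℕ) (x r : List Bool), B.eval x.length ≤ r.length →
      clockFn p B (boolPair x r) = ones (p.eval x.length) ++ false :: boolPair x r) :
    ¬ ∀ p B : Polynomial ℕ, ∃ a : ℕ, TimeComputable id id (clockFn p B) fun n => a * n + a := by
  intro h
  refine clock_not_linearTime (p := X ^ 2) (B := 0) (clockFn (X ^ 2) 0) (hclock _ _) ?_ (h _ _)
  intro κ
  refine ⟨κ + 2, ?_⟩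
  simp only [eval_zero, eval_pow, eval_X, zero_add]
  nlinarith

end Summit.QuantumAdvantage.QuantumAdvantage.Theorems.CompactnessPrinciple.Negative
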